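import Summits.Langlands.Langlands.Theses.OrdinaryPrimeTransport
import Literature.NumberTheory.Automorphic.AutomorphicInductionUnitaryCharacterCubic
import Literature.NumberTheory.Automorphic.BaseChangeInductionAlongProofs
import Literature.NumberTheory.Automorphic.CubicBaseChangeNonNormal
import Literature.NumberTheory.Automorphic.IsAutomorphicAE
import HarnessLib

/-!
# SKELETON — line `CubicInductionGL2` for the crux `ReciprocityUpToIrreducibility`
# (item stmt-Langlands-14328; routes IrreducibilityBySelfDuality / OrdinaryPrimeTransport)
# forward generator G4 ladder-down, generation 23 (unit fwd2-ladder-Langlands-14328-g23)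

Dial θ25 = the RANK `m` of the cuspidal representation `π_E` of `GL_m(𝔸_E)` that is automorphically INDUCED through an
ARBITRARY (possibly non-normal, Galois closure `S₃`) CUBIC extension `E/F` of ARBITRARY number fields, typed inside
clause (B) of the top E = `ReciprocityUpToIrreducibility` (a.e. Satake form): for every cuspidal `π_E` on `GL_m/E` with
unitary central character and every irreducible geometric `ρ : Γ_F → GL_{3m}(ℚ̄_ℓ)` whose Frobenius characteristic
polynomials are, at almost every place `v` of `F`, the Arthur–Clozel induced polynomials
`∏_{w ∣ v} P_{π_E,w}(X^{f(w|v)})` (`inducedSatakePolynomial`, read through `ι` in the tree's `L`-normalised dictionary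
`arithFrobPolyOfSatake`), `ρ` is attached at almost all places to an automorphic representation of `GL_{3m}(𝔸_F)` —
i.e. AUTOMORPHIC INDUCTION `ᴸ(Res_{E/F} GL_m) → ᴸGL_{3m}` ALONG ARBITRARY CUBICS, rank by rank.

FLOOR `m = 1` = Jacquet–Piatetski-Shapiro–Shalika 1979 (GL(3) converse theorem; Gelbart 1997 Thm. 5.3.1 / Rem. 5.3.1
(e): "does not depend on K being a normal extension"): in-tree named fact
`Literature.NumberTheory.Automorphic.automorphicInduction_unitaryCharacter_cubic`, clause (1) — `floor_one` below (a
cuspidal `π_E` on `GL₁/E` with unitary central character `ω` has Satake parameters `{ω(ϖ_w)}`).  The same floor fact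
carries generation 19's orthogonal dial θ21 (degree `d` of the extension at rank `1`; its rung `d = 4`); θ25 moves the
OTHER coordinate of the grid `(m, d)`: `(1,3) → (2,3)`.  THE RUNG `m = 2` (`CubicInductionGL2`): automorphic induction
of cuspidal representations of `GL₂(𝔸_E)` through arbitrary cubics `E/F` to `GL₆(𝔸_F)`.  Cells by `IsGalois F E`:
the CYCLIC cell (`E/F` Galois, hence cyclic of prime degree) is Arthur–Clozel, AMS 120, Ch. 3 Thm. 6.2 — PROVED
below from the in-tree named fact `automorphicInduction_cyclic` for every rank (`cyclicCell_of_AC`); the NON-NORMAL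
cell (`NonNormalCubicInductionGL2`) is the OPEN CORE.  Located stop: the GL(6) converse theorem (Cogdell–
Piatetski-Shapiro 1999: twists by cusp forms on `GL_r/F`, `r ≤ 4`) needs `L(s, AI(π_E) × τ) = L(s, π_E × BC_{E/F}(τ))`,
i.e. NON-NORMAL CUBIC BASE CHANGE of `GL_r/F` cusp forms for `r ≤ 4` — known for `r ≤ 2` only (JPSS 1981, in tree:
`JPSS1981_exists_weakBaseChangeLift_cubic`); the solvable-closure route (`F ⊂ K = F(√disc) ⊂ Ẽ`) produces the
`Gal(K/F)`-stable cuspidal `AI_{Ẽ/K}(BC_{Ẽ/E} π_E)` on `GL₆/K`, whose descent to `F` is pinned only up to the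
quadratic character of `K/F` independently at the density-`1/2` set of inert places unless Galois representations are
attached to every candidate (regular algebraic polarizable `π_E` over totally real / CM fields with fibrewise-distinct
weights: Arthur–Clozel + the soluble descent lemma of Barnet-Lamb–Geraghty–Harris–Taylor, Lemma 1.3/1.4) — so the open
core is `π_E` of parallel weight (elliptic curves over non-normal totally real cubic fields: the abelian threefold
`Res_{E/ℚ} A` on `GL₆/ℚ`), Maass-type `π_E`, or general `F`.  The cap-lifting input is typed as a stub:
`CubicBaseChangeUpTo 4` (non-normal cubic base change up to rank `4`).

Six registered stubs; kernel-checked composition `ReciprocityUpToIrreducibility_of : <stub₁-sig> → … → <stub₆-sig> → E`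
and `reciprocityUpToIrreducibility_holds : E` BY NAME.  PUBLISHED COPY: typed against the `OrdinaryPrimeTransport` decl of the
SHARED item stmt-Langlands-14328 (convention of the registered lines g19–g22: the crux-write farm path cannot serve the
`IrreducibilityBySelfDuality` module — `remote:incoherent`); the REGISTERED skeleton (`ledger skeleton check`, seat folder
`Sketch.lean`, identical modulo this one import) concludes the item's primary decl
`Summit.Langlands.Langlands.Theses.IrreducibilityBySelfDuality.ReciprocityUpToIrreducibility`; the two are `Iff.rfl`-equal:

* `stub_printedInductions : automorphicInduction_unitaryCharacter_cubic ∧ automorphicInduction_cyclic` — the floor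
  (JPSS 1979) and cyclic prime-degree automorphic induction (Arthur–Clozel Thm. III.6.2): in print, vendored named facts;
* `stub_cubicBaseChangeGL4 : CubicBaseChangeUpTo 4` — **THE CAP-LIFTING INPUT (open for `r = 4`; `r ≤ 2` = JPSS 1981,
  `r = 3` pinned by the central character)**: weak base change of cusp forms of `GL_r/F`, `r ≤ 4`, to a non-normal cubic;
* `stub_converseRoute : CubicBaseChangeUpTo 4 → NonNormalCubicInductionGL2` — the printed engine run at rank 6
  (CPS 1999 converse theorem with twists of rank `≤ 4` unramified at a finite set + JPSS 1983 Rankin–Selberg + LLC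
  local induction; in print modulo assembly, plausibly L/XL);
* `stub_higherRanks : HigherRanks` — the non-normal cells `m ≥ 3` (gap above the rung);
* `stub_sectorMerge : (∀ m, CubicInducedReciprocity m) → SectorGaloisToAutomorphic` — upgrade a.e.-Satake automorphy
  on the cubic-induced sector to clause (B) of E verbatim (cuspidal, `L`-algebraic, `Corresponds`);
* `stub_offSector : OffSectorReciprocity` — E with clause (B) restricted OFF the sector (the honest complement).

Composition: `Rec` and clause (A) from `stub_offSector`; clause (B) by `by_cases InCubicInducedSector F ℓ ι ρ`.
Sorries ONLY inside the six `stub_*`.  Also recorded (sorry-free): `floor_one` (F3), `family_zero`, `cyclicCell_of_AC`,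
`family_of_cells`, `rung_of_cells`, `family_of`, `cubicBaseChange_rank_two` (JPSS 1981 = the `r = 2` instance of the
cap-lift), `CubicInductionGL2_of_top : E → rung`, `cubicInducedReciprocity_of_langlands : Langlands → family m` (F4).
-/

noncomputable section

set_option linter.dupNamespace false

open scoped MatrixGroups Matrix NumberField Classical Polynomial
open Filter IsDedekindDomain Field Polynomial NumberField
open Literature.NumberTheory.Automorphic Literature.NumberTheory.GaloisRepresentations
open Literature.NumberTheory.PAdicHodge
open Summit.Langlands

namespace Summit.Langlands.Langlands.Cruxes.ReciprocityUpToIrreducibility.CubicInductionGL2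

/-- Hecke characters: the trivial character inhabits the carrier (recorded for the tribunal's carrier probe).
[folklore] -/
instance instInhabitedHeckeCharacter (K : Type) [Field K] [NumberField K] : Inhabited (HeckeCharacter K) := ⟨1⟩

/-! ## 1. The family, the rung, the cells -/

/-- **The RUNG FAMILY, dial = the rank `m` of the induced representation** (verbatim as in `_onpath` / `_special`):
for all number fields `F`, all CUBIC extensions `E/F` (ANY Galois closure: `C₃` or `S₃`), all cuspidal automorphic
`π_E` of `GL_m(𝔸_E)` (`0 < m`) with UNITARY central character (the Hecke character `ω` with `ω(ϖ_w) = det t_{π_E,w}`,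
Borel–Jacquet 5.7; at `m = 1` this is the floor's `θ.IsUnitary`), all `ℓ, ι` and all framed
`ρ : Γ_F → GL_{3m}(ℚ̄_ℓ)` which are irreducible, de Rham above `ℓ` (Fontaine's pinned datum) and, at almost every place
`v`, unramified with Frobenius characteristic polynomial the `ι`-transport of the Arthur–Clozel induced polynomial
`∏_{w ∣ v} P_{π_E,w}(X^{f(w|v)})` of the Satake data of `π_E` above `v` (through any multiset `α` of its roots, in the
dictionary `arithFrobPolyOfSatake`): `ρ` is attached at almost all places to an automorphic representation of
`GL_{3m}(𝔸_F)`. -/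
def CubicInducedReciprocity (m : ℕ) : Prop :=
  ∀ (F E : Type) [Field F] [NumberField F] [Field E] [NumberField E] [Algebra F E],
    Module.finrank F E = 3 → 0 < m →
    ∀ (hE : isCompact_glFiniteIntegralLevel m E) (πE : CuspidalAutomorphicRepData m E hE),
      (∃ ω : HeckeCharacter E, ω.IsUnitary ∧
          ∀ (w : HeightOneSpectrum (𝓞 E)) (α : Multiset ℂ), πE.1.HasSatakeParamAt w α →
            ω.valueAtUniformizer w = α.prod) →
      ∀ (hF : isCompact_glFiniteIntegralLevel (3 * m) F) (ℓ : ℕ) [Fact ℓ.Prime] (ι : PadicAlgCl ℓ ≃+* ℂ)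
        (ρ : FramedGaloisRep F (PadicAlgCl ℓ) (3 * m)),
        ρ.toGaloisRep.IsIrreducible →
        (∀ (w : HeightOneSpectrum (𝓞 F)) (hw : ((ℓ : ℕ) : 𝓞 F) ∈ w.asIdeal),
            (fontainePstAdicCompletion w ℓ hw).IsDeRhamFramed (ρ.toLocal w)) →
        (∀ᶠ v : HeightOneSpectrum (𝓞 F) in cofinite, ρ.IsUnramifiedAt v ∧
            ∀ β : HeightOneSpectrum (𝓞 E) → Multiset ℂ,
              (∀ w : HeightOneSpectrum (𝓞 E), w.asIdeal.under (𝓞 F) = v.asIdeal →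
                  πE.1.HasSatakeParamAt w (β w)) →
              ∀ α : Multiset ℂ, satakePolynomial α = inducedSatakePolynomial v β →
                ρ.HasFrobCharpolyAt v (arithFrobPolyOfSatake ι v.residueCard 1 α)) →
        ∃ π : AutomorphicRepData (AutomorphyDatum.gl (3 * m) F hF), SatakeFrobCompatibleAE ι π ρ

/-- **THE RUNG (θ25 = 2)**: automorphic induction of cuspidal representations of `GL₂(𝔸_E)` through ARBITRARY cubic
extensions `E/F` to `GL₆(𝔸_F)`, in clause-(B) form. -/
def CubicInductionGL2 : Prop := CubicInducedReciprocity 2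

/-- **The CYCLIC cell at rank `m`** (`E/F` Galois, hence cyclic of prime degree `3`): Arthur–Clozel automorphic
induction — the in-print cell, proved below from the named fact `automorphicInduction_cyclic`. -/
def CyclicCubicCell (m : ℕ) : Prop :=
  ∀ (F E : Type) [Field F] [NumberField F] [Field E] [NumberField E] [Algebra F E],
    Module.finrank F E = 3 → IsGalois F E → 0 < m →
    ∀ (hE : isCompact_glFiniteIntegralLevel m E) (πE : CuspidalAutomorphicRepData m E hE),
      (∃ ω : HeckeCharacter E, ω.IsUnitary ∧
          ∀ (w : HeightOneSpectrum (𝓞 E)) (α : Multiset ℂ), πE.1.HasSatakeParamAt w α →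
            ω.valueAtUniformizer w = α.prod) →
      ∀ (hF : isCompact_glFiniteIntegralLevel (3 * m) F) (ℓ : ℕ) [Fact ℓ.Prime] (ι : PadicAlgCl ℓ ≃+* ℂ)
        (ρ : FramedGaloisRep F (PadicAlgCl ℓ) (3 * m)),
        ρ.toGaloisRep.IsIrreducible →
        (∀ (w : HeightOneSpectrum (𝓞 F)) (hw : ((ℓ : ℕ) : 𝓞 F) ∈ w.asIdeal),
            (fontainePstAdicCompletion w ℓ hw).IsDeRhamFramed (ρ.toLocal w)) →
        (∀ᶠ v : HeightOneSpectrum (𝓞 F) in cofinite, ρ.IsUnramifiedAt v ∧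
            ∀ β : HeightOneSpectrum (𝓞 E) → Multiset ℂ,
              (∀ w : HeightOneSpectrum (𝓞 E), w.asIdeal.under (𝓞 F) = v.asIdeal →
                  πE.1.HasSatakeParamAt w (β w)) →
              ∀ α : Multiset ℂ, satakePolynomial α = inducedSatakePolynomial v β →
                ρ.HasFrobCharpolyAt v (arithFrobPolyOfSatake ι v.residueCard 1 α)) →
        ∃ π : AutomorphicRepData (AutomorphyDatum.gl (3 * m) F hF), SatakeFrobCompatibleAE ι π ρ

/-- **The NON-NORMAL cell at rank `m`** (`E/F` not Galois: Galois closure `S₃`, e.g. `ℚ(∛2)/ℚ` or a totally real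
`S₃`-cubic) — open for every `m ≥ 2`. -/
def NonNormalCubicCell (m : ℕ) : Prop :=
  ∀ (F E : Type) [Field F] [NumberField F] [Field E] [NumberField E] [Algebra F E],
    Module.finrank F E = 3 → ¬ IsGalois F E → 0 < m →
    ∀ (hE : isCompact_glFiniteIntegralLevel m E) (πE : CuspidalAutomorphicRepData m E hE),
      (∃ ω : HeckeCharacter E, ω.IsUnitary ∧
          ∀ (w : HeightOneSpectrum (𝓞 E)) (α : Multiset ℂ), πE.1.HasSatakeParamAt w α →
            ω.valueAtUniformizer w = α.prod) →
      ∀ (hF : isCompact_glFiniteIntegralLevel (3 * m) F) (ℓ : ℕ) [Fact ℓ.Prime] (ι : PadicAlgCl ℓ ≃+* ℂ)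
        (ρ : FramedGaloisRep F (PadicAlgCl ℓ) (3 * m)),
        ρ.toGaloisRep.IsIrreducible →
        (∀ (w : HeightOneSpectrum (𝓞 F)) (hw : ((ℓ : ℕ) : 𝓞 F) ∈ w.asIdeal),
            (fontainePstAdicCompletion w ℓ hw).IsDeRhamFramed (ρ.toLocal w)) →
        (∀ᶠ v : HeightOneSpectrum (𝓞 F) in cofinite, ρ.IsUnramifiedAt v ∧
            ∀ β : HeightOneSpectrum (𝓞 E) → Multiset ℂ,
              (∀ w : HeightOneSpectrum (𝓞 E), w.asIdeal.under (𝓞 F) = v.asIdeal →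
                  πE.1.HasSatakeParamAt w (β w)) →
              ∀ α : Multiset ℂ, satakePolynomial α = inducedSatakePolynomial v β →
                ρ.HasFrobCharpolyAt v (arithFrobPolyOfSatake ι v.residueCard 1 α)) →
        ∃ π : AutomorphicRepData (AutomorphyDatum.gl (3 * m) F hF), SatakeFrobCompatibleAE ι π ρ

/-- **The cyclic cell of the rung** (`m = 2`, `E/F` cyclic cubic: Arthur–Clozel). -/
def CyclicCubicInductionGL2 : Prop := CyclicCubicCell 2

/-- **THE OPEN CORE of the rung — the non-normal cell at `m = 2`**: automorphic induction of `GL₂(𝔸_E)` cusp forms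
through a NON-NORMAL cubic `E/F` (closure `S₃`) to `GL₆(𝔸_F)`. -/
def NonNormalCubicInductionGL2 : Prop := NonNormalCubicCell 2

/-- The non-normal cells `m ≥ 3` of the family (the gap above the rung). -/
def HigherRanks : Prop := ∀ m : ℕ, 3 ≤ m → NonNormalCubicCell m

/-- **The cap-lifting input, typed: NON-NORMAL CUBIC BASE CHANGE up to rank `r`.**  For every cubic `E/F` (any
closure) and every cuspidal `τ` on `GL_n(𝔸_F)`, `0 < n ≤ r`, a weak base change lift of `τ` to `GL_n(𝔸_E)` exists
(`IsBaseChangeLiftAlong` = the tree's `IsWeakBaseChangeLiftAE`: Satake parameters `t_{τ,v}^{f(w|v)}` at almost every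
`w`).  `r = 2` is Jacquet–Piatetski-Shapiro–Shalika 1981 (`cubicBaseChange_rank_two`); `r = 3` is pinned by the central
character (odd rank: the quadratic descent `Ẽ → E` of the Arthur–Clozel lift is decided by `det`); `r = 4` is OPEN —
the input the GL(6) converse theorem consumes (`stub_converseRoute`). -/
def CubicBaseChangeUpTo (r : ℕ) : Prop :=
  ∀ (F E : Type) [Field F] [NumberField F] [Field E] [NumberField E] [Algebra F E],
    Module.finrank F E = 3 → ∀ n : ℕ, 0 < n → n ≤ r →
      ∀ (hF : isCompact_glFiniteIntegralLevel n F) (hE : isCompact_glFiniteIntegralLevel n E)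
        (τ : CuspidalAutomorphicRepData n F hF),
        ∃ P : AutomorphicRepData (AutomorphyDatum.gl n E hE), IsBaseChangeLiftAlong τ.1 P

/-! ## 2. Floor, vacuous member, the cyclic cell for every rank, the rung from its cells (sorry-free) -/

/-- **F3: the family at `m = 1` IS the floor** (JPSS 1979, clause (1) of the in-tree named fact): a cuspidal `π_E` on
`GL₁/E` with unitary central character `ω` has Satake parameter `{ω(ϖ_w)}` at every unramified `w` (a Satake parameter
of `GL₁` is a singleton, `HasSatakeParamAt.card_eq`), so the induced polynomial of `π_E` is the floor's
`∏_{w ∣ v} (X^{f(w|v)} - ω(ϖ_w))` (`finprod_under_eq_inducedSatakePolynomial`). -/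
theorem floor_one (h : automorphicInduction_unitaryCharacter_cubic) : CubicInducedReciprocity 1 := by
  intro F E _ _ _ _ _ h3 _hm hE πE hω hF ℓ _ ι ρ _hirr _hdR hfrob
  obtain ⟨ω, hωu, hω⟩ := hω
  obtain ⟨π, hπ⟩ := (h F E h3 ω hωu hF).1
  have hπ' : ∀ᶠ v : HeightOneSpectrum (𝓞 F) in cofinite, ∃ α : Multiset ℂ, π.HasSatakeParamAt v α ∧
      satakePolynomial α = inducedSatakePolynomial v (fun w => ({ω.valueAtUniformizer w} : Multiset ℂ)) :=
    hπ.mono fun v ⟨α, hα, hp⟩ =>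
      ⟨α, hα, (satakePolynomial_eq_finprod_iff_eq_inducedSatakePolynomial ω v α).1 hp⟩
  refine ⟨π, ?_⟩
  filter_upwards [hπ', hfrob, πE.1.eventually_exists_forall_hasSatakeParamAt_above (K := F)] with v ⟨α, hα, hpoly⟩
    ⟨hunr, hfr⟩ ⟨β, hβ⟩
  refine ⟨α, hα, hunr, hfr β hβ α ?_⟩
  rw [hpoly]
  refine inducedSatakePolynomial_congr v fun w hw => ?_
  have hsat := hβ w hw
  obtain ⟨b, hb⟩ := Multiset.card_eq_one.1 hsat.card_eq
  have hval := hω w (β w) hsat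
  rw [hb, Multiset.prod_singleton] at hval
  rw [hb, hval]

/-- The rank-zero member is vacuous (`0 < m`). -/
theorem family_zero : CubicInducedReciprocity 0 := by
  intro F E _ _ _ _ _ _ hm
  exact absurd hm (lt_irrefl 0)

/-- A Galois cubic extension has cyclic Galois group (a group of prime order is cyclic). [folklore] -/
theorem isCyclic_aut_of_isGalois_cubic {F E : Type} [Field F] [Field E] [Algebra F E] [FiniteDimensional F E]
    (h3 : Module.finrank F E = 3) [IsGalois F E] : IsCyclic (E ≃ₐ[F] E) := by
  haveI : Fact (Nat.Prime 3) := ⟨Nat.prime_three⟩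
  have hcard : Nat.card (E ≃ₐ[F] E) = 3 := by
    rw [IsGalois.card_aut_eq_finrank, h3]
  exact isCyclic_of_prime_card (p := 3) hcard

/-- **The cyclic cell for EVERY rank from Arthur–Clozel** (AMS 120, Ch. 3 Thm. 6.2 = the in-tree named fact
`automorphicInduction_cyclic`): the weak automorphic induction `P` of `π_E` has, at almost every `v`, a Satake
parameter with polynomial `inducedSatakePolynomial v β` — exactly the hypothesis under which `ρ` has the matching
Frobenius polynomial. -/
theorem cyclicCell_of_AC (hAC : automorphicInduction_cyclic) (m : ℕ) : CyclicCubicCell m := by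
  intro F E _ _ _ _ _ h3 hG hm hE πE _hω hF ℓ _ ι ρ _hirr _hdR hfrob
  haveI : IsGalois F E := hG
  have hcyc : IsCyclic (E ≃ₐ[F] E) := isCyclic_aut_of_isGalois_cubic h3
  have e : m * Module.finrank F E = 3 * m := by rw [h3, mul_comm]
  have hK : isCompact_glFiniteIntegralLevel (m * Module.finrank F E) F := by rw [e]; exact hF
  obtain ⟨P, hP⟩ := exists_isAutomorphicInductionAlong_of_rank_eq e hF (hAC m F E hcyc hm hE hK πE)
  refine ⟨P, ?_⟩
  filter_upwards [hP, hfrob, πE.1.eventually_exists_forall_hasSatakeParamAt_above (K := F)] with v hv ⟨hunr, hfr⟩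
    ⟨β, hβ⟩
  obtain ⟨α, hα, hpoly⟩ := hv β hβ
  exact ⟨α, hα, hunr, hfr β hβ α hpoly⟩

/-- **A rank from its two cells** (cyclic + non-normal cubics). -/
theorem family_of_cells (m : ℕ) (hcyc : CyclicCubicCell m) (hnn : NonNormalCubicCell m) :
    CubicInducedReciprocity m := by
  intro F E _ _ _ _ _ h3 hm hE πE hω hF ℓ _ ι ρ hirr hdR hfrob
  by_cases hG : IsGalois F E
  · exact hcyc F E h3 hG hm hE πE hω hF ℓ ι ρ hirr hdR hfrob
  · exact hnn F E h3 hG hm hE πE hω hF ℓ ι ρ hirr hdR hfrob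

/-- **The rung from its two cells.** -/
theorem rung_of_cells (hcyc : CyclicCubicInductionGL2) (hnn : NonNormalCubicInductionGL2) : CubicInductionGL2 :=
  family_of_cells 2 hcyc hnn

/-- **Every rank** from the two printed induction theorems, the cap-lifting input with the converse-theorem engine at
rank `6`, and the higher non-normal cells. -/
theorem family_of (hprint : automorphicInduction_unitaryCharacter_cubic ∧ automorphicInduction_cyclic)
    (hbc : CubicBaseChangeUpTo 4) (hconv : CubicBaseChangeUpTo 4 → NonNormalCubicInductionGL2)
    (hhigh : HigherRanks) (m : ℕ) : CubicInducedReciprocity m := by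
  rcases Nat.lt_or_ge m 3 with h | h
  · interval_cases m
    · exact family_zero
    · exact floor_one hprint.1
    · exact rung_of_cells (cyclicCell_of_AC hprint.2 2) (hconv hbc)
  · exact family_of_cells m (cyclicCell_of_AC hprint.2 m) (hhigh m h)

/-- **The `r = 2` instance of the cap-lift is Jacquet–Piatetski-Shapiro–Shalika 1981** (in-tree named fact
`JPSS1981_exists_weakBaseChangeLift_cubic`, Tunnell's extra input): non-normal cubic base change for `GL₂`. -/
theorem cubicBaseChange_rank_two (h : JPSS1981_exists_weakBaseChangeLift_cubic)
    (F E : Type) [Field F] [NumberField F] [Field E] [NumberField E] [Algebra F E] (h3 : Module.finrank F E = 3)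
    (hF : isCompact_glFiniteIntegralLevel 2 F) (hE : isCompact_glFiniteIntegralLevel 2 E)
    (τ : CuspidalAutomorphicRepData 2 F hF) :
    ∃ P : AutomorphicRepData (AutomorphyDatum.gl 2 E hE), IsBaseChangeLiftAlong τ.1 P :=
  h F E h3 hF hE τ

/-! ## 3. The cubic-induced sector of clause (B), the merge target, the off-sector complement -/

/-- **The cubic-induced sector of clause (B)** at `(F, ℓ, ι, ρ)`, `ρ` of rank `n`: for some cubic `E/F`, some
`m` with `3m = n` and some cuspidal `π_E` on `GL_m/E` with unitary central character, `ρ` is, at almost every place,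
unramified with Frobenius characteristic polynomial the `ι`-transport of the induced polynomial of `π_E`
(so `ρ` "is" `Ind_E^F ρ_{π_E}`). -/
def InCubicInducedSector (F : Type) [Field F] [NumberField F] (ℓ : ℕ) [Fact ℓ.Prime] (ι : PadicAlgCl ℓ ≃+* ℂ)
    {n : ℕ} (ρ : FramedGaloisRep F (PadicAlgCl ℓ) n) : Prop :=
  ∃ (E : Type) (_ : Field E) (_ : NumberField E) (_ : Algebra F E) (m : ℕ)
    (hE : isCompact_glFiniteIntegralLevel m E) (πE : CuspidalAutomorphicRepData m E hE),
    Module.finrank F E = 3 ∧ 0 < m ∧ 3 * m = n ∧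
    (∃ ω : HeckeCharacter E, ω.IsUnitary ∧
        ∀ (w : HeightOneSpectrum (𝓞 E)) (α : Multiset ℂ), πE.1.HasSatakeParamAt w α →
          ω.valueAtUniformizer w = α.prod) ∧
    ∀ᶠ v : HeightOneSpectrum (𝓞 F) in cofinite, ρ.IsUnramifiedAt v ∧
      ∀ β : HeightOneSpectrum (𝓞 E) → Multiset ℂ,
        (∀ w : HeightOneSpectrum (𝓞 E), w.asIdeal.under (𝓞 F) = v.asIdeal → πE.1.HasSatakeParamAt w (β w)) →
        ∀ α : Multiset ℂ, satakePolynomial α = inducedSatakePolynomial v β →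
          ρ.HasFrobCharpolyAt v (arithFrobPolyOfSatake ι v.residueCard 1 α)

/-- **Merge target**: clause (B) of E VERBATIM (cuspidal, `L`-algebraic, `Corresponds Rec ι π ρ`) for EVERY reciprocity
datum `Rec`, on the cubic-induced sector. -/
def SectorGaloisToAutomorphic : Prop :=
  ∀ (F : Type) [Field F] [NumberField F] (Rec : ReciprocityData F) (n : ℕ), 0 < n →
    ∀ (hcpt : isCompact_glFiniteIntegralLevel n F) (ℓ : ℕ) [Fact ℓ.Prime] (ι : PadicAlgCl ℓ ≃+* ℂ)
      (ρ : FramedGaloisRep F (PadicAlgCl ℓ) n),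
      ρ.toGaloisRep.IsIrreducible → IsGeometricFramed Rec ρ → InCubicInducedSector F ℓ ι ρ →
        ∃ π : CuspidalAutomorphicRepData n F hcpt, π.1.IsLAlgebraic ∧ Corresponds Rec ι π.1 ρ

/-- **The off-sector complement**: E (`ReciprocityUpToIrreducibility`) with clause (A) entire and clause (B)
restricted to `ρ` NOT in the cubic-induced sector. -/
def OffSectorReciprocity : Prop :=
  ∀ (F : Type) [Field F] [NumberField F], ∃ Rec : ReciprocityData F, ∀ n : ℕ, 0 < n →
    ∀ hcpt : isCompact_glFiniteIntegralLevel n F,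
      (∀ π : CuspidalAutomorphicRepData n F hcpt, π.1.IsLAlgebraic →
        ∀ (ℓ : ℕ) [Fact ℓ.Prime] (ι : PadicAlgCl ℓ ≃+* ℂ),
          ∃ ρ : FramedGaloisRep F (PadicAlgCl ℓ) n, IsGeometricFramed Rec ρ ∧ Corresponds Rec ι π.1 ρ) ∧
      (∀ (ℓ : ℕ) [Fact ℓ.Prime] (ι : PadicAlgCl ℓ ≃+* ℂ) (ρ : FramedGaloisRep F (PadicAlgCl ℓ) n),
        ρ.toGaloisRep.IsIrreducible → IsGeometricFramed Rec ρ → ¬ InCubicInducedSector F ℓ ι ρ →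
          ∃ π : CuspidalAutomorphicRepData n F hcpt, π.1.IsLAlgebraic ∧ Corresponds Rec ι π.1 ρ)

/-! ## 4. The six registered stubs -/

/-- The two PRINTED induction theorems the line consumes as named facts: the floor (Jacquet–Piatetski-Shapiro–Shalika
1979, any cubic, rank 1) and Arthur–Clozel automorphic induction along cyclic prime-degree extensions (AMS 120,
Ch. 3 Thm. 6.2, any rank).  In print; XL to discharge in the tree. -/
theorem stub_printedInductions : automorphicInduction_unitaryCharacter_cubic ∧ automorphicInduction_cyclic := by
  sorry

/-- **THE CAP-LIFTING INPUT — non-normal cubic base change up to rank 4** (`r ≤ 2`: JPSS 1981, in tree; `r = 3`: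
central-character descent of the Arthur–Clozel lift over the `S₃`-closure; `r = 4`: OPEN — even rank, the quadratic
descent `Ẽ → E` is invisible to the central character and the GL(4)/E converse theorem needs `GL₂/E`-twists, i.e. the
rung itself). -/
theorem stub_cubicBaseChangeGL4 : CubicBaseChangeUpTo 4 := by
  sorry

/-- **The printed engine at rank 6**: given weak base change to `E` of all cusp forms of `GL_r/F`, `r ≤ 4`, the
Cogdell–Piatetski-Shapiro converse theorem for `GL₆/F` (twists of rank `≤ 6 - 2` unramified at a chosen finite set,
with a fixed highly ramified twist to kill poles) applied to `Π = ⊗_v AI(π_{E,v})` with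
`L(s, Π × τ) := L(s, π_E × BC_{E/F}(τ))` (JPSS 1983 Rankin–Selberg on `GL₂ × GL_r` over `E`; local factors through the
local Langlands correspondence) yields the automorphic induction of `π_E`, hence the non-normal cell at `m = 2`.
In print modulo assembly (exact local factors at the ramified places of `BC(τ)`); plausibly L/XL. -/
theorem stub_converseRoute : CubicBaseChangeUpTo 4 → NonNormalCubicInductionGL2 := by
  sorry

/-- The non-normal cells `m ≥ 3` (open; the converse route at rank `3m` would need cubic base change up to rank
`3m - 2`). -/
theorem stub_higherRanks : HigherRanks := by
  sorry

/-- Upgrade a.e.-Satake automorphy on the cubic-induced sector to clause (B) of E verbatim (cuspidality from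
irreducibility via Jacquet–Shalika, `L`-algebraicity from the weight of `ρ`, local-global compatibility at every
place; plausibly L given clause (A)-type inputs on the sector). -/
theorem stub_sectorMerge : (∀ m : ℕ, CubicInducedReciprocity m) → SectorGaloisToAutomorphic := by
  sorry

/-- E with clause (B) restricted OFF the cubic-induced sector (the honest complement). -/
theorem stub_offSector : OffSectorReciprocity := by
  sorry

/-! ## 5. Composition (no sorry below this line) -/

/-- **COMPOSITION — the crux BY NAME from the six stub statements.**  `Rec` and clause (A) come from the off-sector
statement; clause (B) is a case split on the cubic-induced sector. -/
theorem ReciprocityUpToIrreducibility_of :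
    (automorphicInduction_unitaryCharacter_cubic ∧ automorphicInduction_cyclic) →
    CubicBaseChangeUpTo 4 → (CubicBaseChangeUpTo 4 → NonNormalCubicInductionGL2) → HigherRanks →
    ((∀ m : ℕ, CubicInducedReciprocity m) → SectorGaloisToAutomorphic) →
    OffSectorReciprocity →
    Summit.Langlands.Langlands.Theses.OrdinaryPrimeTransport.ReciprocityUpToIrreducibility := by
  intro hprint hbc hconv hhigh hmerge hoff F _ _
  obtain ⟨Rec, hall⟩ := hoff F
  refine ⟨Rec, fun n hn hcpt => ⟨(hall n hn hcpt).1, ?_⟩⟩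
  intro ℓ _ ι ρ hirr hgeo
  by_cases hsec : InCubicInducedSector F ℓ ι ρ
  · exact hmerge (family_of hprint hbc hconv hhigh) F Rec n hn hcpt ℓ ι ρ hirr hgeo hsec
  · exact (hall n hn hcpt).2 ℓ ι ρ hirr hgeo hsec

/-- **THE REGISTERED SKELETON THEOREM** — the item's decl from the six registered stubs (audit: proof-of-item modulo
the six sorries).  NOTE for reshaping: `ledger skeleton check` (`#h21_check_skeleton`) takes the FIRST theorem
concluding the crux in environment order as the skeleton and requires it to have no hypotheses beyond registered
stubs; with this name that is this theorem — keep the name when editing. -/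
theorem reciprocityUpToIrreducibility_holds :
    Summit.Langlands.Langlands.Theses.OrdinaryPrimeTransport.ReciprocityUpToIrreducibility :=
  ReciprocityUpToIrreducibility_of stub_printedInductions stub_cubicBaseChangeGL4 stub_converseRoute stub_higherRanks
    stub_sectorMerge stub_offSector

/-! ## 6. The rung is a consequence of the top and of the summit (sorry-free) -/

/-- `E → CubicInducedReciprocity m` for every `m` (clause (B) of E over `F` for its own `Rec`). -/
theorem cubicInducedReciprocity_of_top (m : ℕ)
    (hE : Summit.Langlands.Langlands.Theses.OrdinaryPrimeTransport.ReciprocityUpToIrreducibility) :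
    CubicInducedReciprocity m := by
  intro F E _ _ _ _ _ _h3 hm hE' πE _hω hF ℓ _ ι ρ hirr hdR hfrob
  obtain ⟨Rec, hall⟩ := hE F
  have hn : 0 < 3 * m := by omega
  have hB : GaloisToAutomorphic (3 * m) Rec hF := (hall (3 * m) hn hF).2
  have hgeo : IsGeometricFramed Rec ρ := ⟨hfrob.mono fun v hv => hv.1, fun w hw => hdR w hw⟩
  obtain ⟨π, _hLalg, hcorr⟩ := hB ℓ ι ρ hirr hgeo
  exact ⟨π.1, hcorr.1⟩

/-- `E → rung`. -/
theorem CubicInductionGL2_of_top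
    (hE : Summit.Langlands.Langlands.Theses.OrdinaryPrimeTransport.ReciprocityUpToIrreducibility) :
    CubicInductionGL2 :=
  cubicInducedReciprocity_of_top 2 hE

/-- `Langlands → CubicInducedReciprocity m` for every `m` (the F4 on-path lemma, also in `_onpath`). -/
theorem cubicInducedReciprocity_of_langlands (m : ℕ) (hL : _root_.Langlands) : CubicInducedReciprocity m := by
  intro F E _ _ _ _ _ _h3 hm hE' πE _hω hF ℓ _ ι ρ hirr hdR hfrob
  obtain ⟨⟨Rec⟩, hall⟩ := hL F
  have hn : 0 < 3 * m := by omega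
  have hB : GaloisToAutomorphic (3 * m) Rec hF := (hall Rec (3 * m) hn hF).2
  have hgeo : IsGeometricFramed Rec ρ := ⟨hfrob.mono fun v hv => hv.1, fun w hw => hdR w hw⟩
  obtain ⟨π, _hLalg, hcorr⟩ := hB ℓ ι ρ hirr hgeo
  exact ⟨π.1, hcorr.1⟩

/-- **F4 on-path lemma**: `S → Rung`. -/
@[aesop safe apply]
theorem CubicInductionGL2_of_Langlands (hL : _root_.Langlands) : CubicInductionGL2 :=
  cubicInducedReciprocity_of_langlands 2 hL

end Summit.Langlands.Langlands.Cruxes.ReciprocityUpToIrreducibility.CubicInductionGL2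

end
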